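/-
Copyright (c) 2026 the pub-hodgecm-mathlib formalisation cell (harness21).  Prover seat hodgecm-mathlib-K2E3-p25 (g2), HCML Track B «K2-LIT»,
h413 = `stmt-HodgeConjecture-24833`, road (11-3-split-nsc), leaf (nsc-S-A′) `sig_K2E3GL3PrincipalBlockStandardSpan` (U12 :463), brick (E4b-T, generic half) of the
leaf owner's E4b spec ∕ K2E3-p14 (g7)'s «NCQ dévissage» (K2 bus 2026-09-04 12:00Z; dealer D104).  2026-09-04.
-/
import Summits.HodgeConjecture.HodgeConjecture.Theorems.K2E3GL3OuterAutomorphismInduction   -- ★ T1: `leviProjection_apply_eq_of_ker`, `continuous_leviProjection_gl`, `continuous_leviEmbeddingP_gl`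
import HarnessLib

/-!
# K2_E3 road (h413), leaf (nsc-S-A′), brick E4b-T (generic half) — transport of Jacquet modules, and of the «no supercuspidal quotient of a subrepresentation»
# property, along a continuous involution of `GL_n(F)` exchanging two standard parabolics

Cell `pub/hodgecm-mathlib` (D-0151), Track B, seat K2E3-p25 (g2) (leaf owner ∕ architect).  `--supports stmt-HodgeConjecture-24833 --as helper`; THEOREMS ONLY
(no `def`, no instance, no notation, no `sorry`); never imports `Cruxes/…/Lines`.  COUNT-NEUTRAL.

THE MATHEMATICS ([BernsteinZelevinsky1976, §2.21–2.25: functoriality of coinvariants in the pair (group, representation)]; [BernsteinZelevinsky1977, §1.8–1.9, §2.3]).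
`θ` a continuous involutive automorphism of `GL_n(F)` with `θ(P_c) = P_{c'}`, `θ(U_c) = U_{c'}` (and back); `π`, `π'` representations of `GL_n(F)` on `V`, `V'` with a
`θ`-EQUIVARIANT linear isomorphism `Φ : V ≃ V'` (`Φ ∘ π(g) = π'(θ g) ∘ Φ`).  Then:
* §1 **`map_coinvariantsKer_eq`** — `Φ (V(U_c)) = V'(U_{c'})` (the spans of the `π(u)v − v` correspond);
* §2 **`ncq_jacquetGL_of_continuousMulEquiv`** — THE TRANSPORT OF THE WEAK CELL LEMMA: if no `M_{c'}`-subrepresentation of `r_{c'} π'` maps non-trivially to an irreducible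
  smooth supercuspidal `σ'` (on `W`), then no `M_c`-subrepresentation of `r_c π` maps non-trivially to an irreducible smooth supercuspidal `σ` (on `W`).  Inside the proof:
  the Levi isomorphism `e : M_{c'} ≃ₜ* M_c`, `e⁻¹ m = proj_{c'}(θ(diag m))` (★ T1 pattern), the induced linear isomorphism `L : r_c π ≃ r_{c'} π'`, `L[v] = [Φ v]`
  (Mathlib `Submodule.Quotient.equiv`), its equivariance `L(m·x) = e⁻¹(m)·L(x)` (`θ(diag m) ∈ diag(e⁻¹ m)·U_{c'}` and `U_{c'}` acts trivially on coinvariants), and the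
  transports `σ' = σ ∘ e` (★ `isIrreducible_comp_of_surjective`, ★ `IsSmooth.comp_of_continuous`, ★ `IsSupercuspidal.comp_continuousMulEquiv`), `N' = L(N)`, `q' = q ∘ L⁻¹`.
The concrete instance (`n = 3`, `θ = gkAutomorphism`, `c = ![0,1,1]`, `c' = ![0,0,1]`, `π = I(χ)`, `π' = I(χ^θ)`) is the companion file `K2E3GL3WeakCellLemmaTransport`.

HONEST LABEL: HC_CM is proved only modulo the 7 printed citations (2 remaining named inputs: hLiu418 = stmt-HodgeConjecture-24832, h413 = stmt-HodgeConjecture-24833) until rung 0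
closes; count-neutral generic helper.

## References
* [BernsteinZelevinsky1976] I. N. Bernstein, A. V. Zelevinsky, *Representations of the group GL(n,F) where F is a non-archimedean local field*, Russian Math. Surveys 31
  (1976), §2.21–2.25.
* [BernsteinZelevinsky1977] I. N. Bernstein, A. V. Zelevinsky, *Induced representations of reductive p-adic groups I*, Ann. Sci. ÉNS 10 (1977), §1.8–1.9, §2.3.
-/

set_option autoImplicit false
set_option linter.dupNamespace false

noncomputable section

open Function Representation
open scoped MatrixGroups
open Literature.NumberTheory.Automorphic
open Summit.HodgeConjecture.HodgeConjecture.Cruxes.H413.K2E3GL3OuterAutomorphismInduction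

namespace Summit.HodgeConjecture.HodgeConjecture.Cruxes.H413.K2E3JacquetModuleAutomorphismTransport

variable (F : Type*) [Field F] [ValuativeRel F] [TopologicalSpace F] [IsNonarchimedeanLocalField F]
  {n : Type*} [Fintype n] [DecidableEq n] {α β : Type*} [LinearOrder α] [Fintype α] [LinearOrder β] [Fintype β]
  (c : n → α) (c' : n → β)

/-! ## §1 `Φ` carries `V(U_c)` onto `V'(U_{c'})` -/

omit [ValuativeRel F] [TopologicalSpace F] [IsNonarchimedeanLocalField F] [Fintype α] [Fintype β] in
/-- **`Φ(V(U_c)) ≤ V'(U_{c'})`** for a `θ`-equivariant linear map `Φ` (`θ(U_c) ⊆ U_{c'}`): `Φ(π(u)v − v) = π'(θu)(Φv) − Φv`. [cite: BernsteinZelevinsky1976, §2.23] -/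
theorem map_coinvariantsKer_le (θ : GL n F ≃* GL n F)
    (hP : ∀ x, θ x ∈ standardParabolicGL F c' ↔ x ∈ standardParabolicGL F c)
    (hU : ∀ p : ↥(standardParabolicGL F c), p ∈ unipotentRadicalP F c →
      (⟨θ p, (hP p).2 p.2⟩ : ↥(standardParabolicGL F c')) ∈ unipotentRadicalP F c')
    {V V' : Type*} [AddCommGroup V] [Module ℂ V] [AddCommGroup V'] [Module ℂ V']
    (π : Representation ℂ (GL n F) V) (π' : Representation ℂ (GL n F) V') (Φ : V →ₗ[ℂ] V')
    (hΦ : ∀ (g : GL n F) (v : V), Φ (π g v) = π' (θ g) (Φ v)) :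
    (Coinvariants.ker (restrictUnipotentGL F c π)).map Φ ≤ Coinvariants.ker (restrictUnipotentGL F c' π') := by
  rw [Submodule.map_le_iff_le_comap]
  refine Submodule.span_le.2 ?_
  rintro _ ⟨⟨u, v⟩, rfl⟩
  rw [SetLike.mem_coe, Submodule.mem_comap]
  refine Coinvariants.mem_ker_of_eq (⟨⟨θ ((u : ↥(standardParabolicGL F c)) : GL n F), (hP _).2 (u : ↥(standardParabolicGL F c)).2⟩, hU _ u.2⟩ :
    ↥(unipotentRadicalP F c')) (Φ v) _ ?_
  change π' (θ ((u : ↥(standardParabolicGL F c)) : GL n F)) (Φ v) - Φ v = Φ (π ((u : ↥(standardParabolicGL F c)) : GL n F) v - v)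
  rw [map_sub, hΦ]

omit [ValuativeRel F] [TopologicalSpace F] [IsNonarchimedeanLocalField F] [Fintype α] [Fintype β] in
/-- **`Φ(V(U_c)) = V'(U_{c'})`** for a `θ`-equivariant linear ISOMORPHISM `Φ` along an INVOLUTION `θ` with `θ(U_c) ⊆ U_{c'}`, `θ(U_{c'}) ⊆ U_c`.
[cite: BernsteinZelevinsky1976, §2.23] -/
theorem map_coinvariantsKer_eq (θ : GL n F ≃* GL n F) (hθθ : ∀ g, θ (θ g) = g)
    (hP : ∀ x, θ x ∈ standardParabolicGL F c' ↔ x ∈ standardParabolicGL F c)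
    (hP' : ∀ x, θ x ∈ standardParabolicGL F c ↔ x ∈ standardParabolicGL F c')
    (hU : ∀ p : ↥(standardParabolicGL F c), p ∈ unipotentRadicalP F c →
      (⟨θ p, (hP p).2 p.2⟩ : ↥(standardParabolicGL F c')) ∈ unipotentRadicalP F c')
    (hU' : ∀ p : ↥(standardParabolicGL F c'), p ∈ unipotentRadicalP F c' →
      (⟨θ p, (hP' p).2 p.2⟩ : ↥(standardParabolicGL F c)) ∈ unipotentRadicalP F c)
    {V V' : Type*} [AddCommGroup V] [Module ℂ V] [AddCommGroup V'] [Module ℂ V']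
    (π : Representation ℂ (GL n F) V) (π' : Representation ℂ (GL n F) V') (Φ : V ≃ₗ[ℂ] V')
    (hΦ : ∀ (g : GL n F) (v : V), Φ (π g v) = π' (θ g) (Φ v)) :
    (Coinvariants.ker (restrictUnipotentGL F c π)).map (Φ : V →ₗ[ℂ] V') = Coinvariants.ker (restrictUnipotentGL F c' π') := by
  refine le_antisymm (map_coinvariantsKer_le F c c' θ hP hU π π' (Φ : V →ₗ[ℂ] V') hΦ) ?_
  -- the reverse inclusion from the symmetric statement for `Φ⁻¹` (θ is an involution)
  have hΦ' : ∀ (g : GL n F) (v' : V'), Φ.symm (π' g v') = π (θ g) (Φ.symm v') := fun g v' => by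
    apply Φ.injective
    rw [LinearEquiv.apply_symm_apply, hΦ, hθθ, LinearEquiv.apply_symm_apply]
  have h := map_coinvariantsKer_le F c' c θ hP' hU' π' π (Φ.symm : V' →ₗ[ℂ] V) hΦ'
  intro x hx
  refine ⟨Φ.symm x, h ⟨x, hx, rfl⟩, Φ.apply_symm_apply x⟩

/-! ## §2 Transport of «no supercuspidal quotient of a subrepresentation of the Jacquet module» -/

omit [ValuativeRel F] [TopologicalSpace F] [IsNonarchimedeanLocalField F] [Fintype α] [Fintype β] in
/-- A class computation in the Jacquet module: for `d ∈ P_c` and `u ∈ U_c`, `[π(d·u) w] = [π(d) w]` (`π(u)w − w ∈ V(U_c)` and `π(d)` preserves `V(U_c)`).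
[cite: BernsteinZelevinsky1977, §1.8] -/
theorem coinvariantsMk_apply_mul_unipotent {V : Type*} [AddCommGroup V] [Module ℂ V] (π : Representation ℂ (GL n F) V)
    (d : ↥(standardParabolicGL F c)) {u : ↥(standardParabolicGL F c)} (hu : u ∈ unipotentRadicalP F c) (w : V) :
    Coinvariants.mk (restrictUnipotentGL F c π) (π ((d : GL n F) * (u : GL n F)) w) =
      Coinvariants.mk (restrictUnipotentGL F c π) (π (d : GL n F) w) := by
  rw [map_mul, Module.End.mul_apply, Coinvariants.mk_eq_iff, ← map_sub]
  exact Coinvariants.le_comap_ker (π.comp (standardParabolicGL F c).subtype) (unipotentRadicalP F c) d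
    (Coinvariants.mem_ker_of_eq (⟨u, hu⟩ : ↥(unipotentRadicalP F c)) w _ rfl)

/-- **TRANSPORT OF THE WEAK CELL LEMMA ALONG A CONTINUOUS INVOLUTION `θ` WITH `θ(P_c) = P_{c'}`, `θ(U_c) = U_{c'}`.**  `Φ : V ≃ V'` `θ`-equivariant
(`Φ(π g v) = π'(θ g)(Φ v)`).  If every `M_{c'}`-map from an `M_{c'}`-subrepresentation of `r_{c'} π'` to an irreducible smooth supercuspidal `σ'` on `W` vanishes, then
every `M_c`-map from an `M_c`-subrepresentation of `r_c π` to an irreducible smooth supercuspidal `σ` on `W` vanishes.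
[cite: BernsteinZelevinsky1976, §2.21–2.25] [cite: BernsteinZelevinsky1977, §2.3] -/
theorem ncq_jacquetGL_of_continuousMulEquiv
    [LocallyCompactSpace ↥(standardParabolicGL F c)] [LocallyCompactSpace ↥(standardParabolicGL F c')]
    (θ : GL n F ≃ₜ* GL n F) (hθθ : ∀ g, θ (θ g) = g)
    (hP : ∀ x, θ x ∈ standardParabolicGL F c' ↔ x ∈ standardParabolicGL F c)
    (hP' : ∀ x, θ x ∈ standardParabolicGL F c ↔ x ∈ standardParabolicGL F c')
    (hU : ∀ p : ↥(standardParabolicGL F c), p ∈ unipotentRadicalP F c →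
      (⟨θ p, (hP p).2 p.2⟩ : ↥(standardParabolicGL F c')) ∈ unipotentRadicalP F c')
    (hU' : ∀ p : ↥(standardParabolicGL F c'), p ∈ unipotentRadicalP F c' →
      (⟨θ p, (hP' p).2 p.2⟩ : ↥(standardParabolicGL F c)) ∈ unipotentRadicalP F c)
    {V V' : Type*} [AddCommGroup V] [Module ℂ V] [AddCommGroup V'] [Module ℂ V']
    (π : Representation ℂ (GL n F) V) (π' : Representation ℂ (GL n F) V') (Φ : V ≃ₗ[ℂ] V')
    (hΦ : ∀ (g : GL n F) (v : V), Φ (π g v) = π' (θ g) (Φ v))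
    {W : Type*} [AddCommGroup W] [Module ℂ W]
    (h' : ∀ (σ' : Representation ℂ (Π b, GL {i // c' i = b} F) W), σ'.IsIrreducible → σ'.IsSmooth → σ'.IsSupercuspidal →
      ∀ (N' : Subrepresentation (jacquetGL F c' π')) (q' : N'.toRepresentation.IntertwiningMap σ'), q' = 0)
    (σ : Representation ℂ (Π a, GL {i // c i = a} F) W) [σ.IsIrreducible] (hσ : σ.IsSmooth) (hsc : σ.IsSupercuspidal)
    (N : Subrepresentation (jacquetGL F c π)) (q : N.toRepresentation.IntertwiningMap σ) : q = 0 := by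
  -- the restrictions of `θ` to the parabolics
  let θP : ↥(standardParabolicGL F c) →* ↥(standardParabolicGL F c') :=
    ((θ : GL n F ≃* GL n F).toMonoidHom.comp (standardParabolicGL F c).subtype).codRestrict _ fun p => (hP p).2 p.2
  let θP' : ↥(standardParabolicGL F c') →* ↥(standardParabolicGL F c) :=
    ((θ : GL n F ≃* GL n F).toMonoidHom.comp (standardParabolicGL F c').subtype).codRestrict _ fun p => (hP' p).2 p.2
  have hθP : ∀ p, ((θP p : ↥(standardParabolicGL F c')) : GL n F) = θ p := fun _ => rfl
  have hθc : Continuous θP := (θ.continuous.comp continuous_subtype_val).subtype_mk _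
  have hθc' : Continuous θP' := (θ.continuous.comp continuous_subtype_val).subtype_mk _
  -- the Levi isomorphism `e : M_{c'} ≃ₜ* M_c`, `e m' = proj_c (θ (diag m'))`, `e⁻¹ m = proj_{c'} (θ (diag m))` (★ T1 pattern)
  let f : (Π b, GL {i // c' i = b} F) →* (Π a, GL {i // c i = a} F) := ((leviProjection F c).comp θP').comp (leviEmbeddingP F c')
  let g : (Π a, GL {i // c i = a} F) →* (Π b, GL {i // c' i = b} F) := ((leviProjection F c').comp θP).comp (leviEmbeddingP F c)
  have key : ∀ p : ↥(standardParabolicGL F c), f (leviProjection F c' (θP p)) = leviProjection F c p := by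
    intro p
    have h1 := leviProjection_apply_eq_of_ker F c' c (θ : GL n F ≃* GL n F) hP' hU' (θP p)
    have h2 : (⟨(θ : GL n F ≃* GL n F) ((θP p : ↥(standardParabolicGL F c')) : GL n F), (hP' _).2 (θP p).2⟩ : ↥(standardParabolicGL F c)) = p :=
      Subtype.ext (hθθ _)
    rw [h2] at h1
    exact h1.symm
  have key' : ∀ p : ↥(standardParabolicGL F c'), g (leviProjection F c (θP' p)) = leviProjection F c' p := by
    intro p
    have h1 := leviProjection_apply_eq_of_ker F c c' (θ : GL n F ≃* GL n F) hP hU (θP' p)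
    have h2 : (⟨(θ : GL n F ≃* GL n F) ((θP' p : ↥(standardParabolicGL F c)) : GL n F), (hP _).2 (θP' p).2⟩ : ↥(standardParabolicGL F c')) = p :=
      Subtype.ext (hθθ _)
    rw [h2] at h1
    exact h1.symm
  have hfg : ∀ m, f (g m) = m := fun m => by
    change f (leviProjection F c' (θP (leviEmbeddingP F c m))) = m
    rw [key, leviProjection_leviEmbeddingP_apply]
  have hgf : ∀ m, g (f m) = m := fun m => by
    change g (leviProjection F c (θP' (leviEmbeddingP F c' m))) = m
    rw [key', leviProjection_leviEmbeddingP_apply]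
  have hfc : Continuous f := ((continuous_leviProjection_gl F c).comp hθc').comp (continuous_leviEmbeddingP_gl F c')
  have hgc : Continuous g := ((continuous_leviProjection_gl F c').comp hθc).comp (continuous_leviEmbeddingP_gl F c)
  let e : (Π b, GL {i // c' i = b} F) ≃ₜ* (Π a, GL {i // c i = a} F) :=
    { toFun := f, invFun := g, left_inv := hgf, right_inv := hfg, map_mul' := f.map_mul, continuous_toFun := hfc, continuous_invFun := hgc }
  have he : ∀ m, e m = f m := fun _ => rfl
  -- `σ' := σ ∘ e` is irreducible, smooth, supercuspidal
  haveI hirr' : Representation.IsIrreducible (σ.comp (e : (Π b, GL {i // c' i = b} F) →* (Π a, GL {i // c i = a} F))) :=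
    isIrreducible_comp_of_surjective σ (e : (Π b, GL {i // c' i = b} F) →* (Π a, GL {i // c i = a} F)) e.surjective
  have hsm' : Representation.IsSmooth (σ.comp (e : (Π b, GL {i // c' i = b} F) →* (Π a, GL {i // c i = a} F))) :=
    IsSmooth.comp_of_continuous σ (e : (Π b, GL {i // c' i = b} F) →* (Π a, GL {i // c i = a} F)) e.continuous hσ
  have hsc' : Representation.IsSupercuspidal (σ.comp (e : (Π b, GL {i // c' i = b} F) →* (Π a, GL {i // c i = a} F))) :=
    hsc.comp_continuousMulEquiv e
  -- the linear isomorphism of coinvariants `L [v] = [Φ v]`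
  have hker := map_coinvariantsKer_eq F c c' (θ : GL n F ≃* GL n F) hθθ hP hP' hU hU' π π' Φ hΦ
  let L : (restrictUnipotentGL F c π).Coinvariants ≃ₗ[ℂ] (restrictUnipotentGL F c' π').Coinvariants :=
    Submodule.Quotient.equiv (Coinvariants.ker (restrictUnipotentGL F c π)) (Coinvariants.ker (restrictUnipotentGL F c' π')) Φ hker
  have hL : ∀ v : V, L (Coinvariants.mk (restrictUnipotentGL F c π) v) = Coinvariants.mk (restrictUnipotentGL F c' π') (Φ v) := fun v => rfl
  -- `L` is equivariant along `g = e⁻¹`: `L (m • x) = g m • L x`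
  have hLm : ∀ (m : Π a, GL {i // c i = a} F) (x : (restrictUnipotentGL F c π).Coinvariants),
      L (jacquetGL F c π m x) = jacquetGL F c' π' (g m) (L x) := by
    intro m x
    induction x using Representation.Coinvariants.induction_on with
    | h v =>
      rw [jacquetGL_mk, hL, hL, jacquetGL_mk, hΦ]
      -- `θ (diag m) = diag (g m) · u'` with `u' ∈ U_{c'}`
      have hu : (leviEmbeddingP F c' (g m))⁻¹ * θP (leviEmbeddingP F c m) ∈ unipotentRadicalP F c' := by
        rw [MonoidHom.mem_ker, map_mul, map_inv, leviProjection_leviEmbeddingP_apply]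
        change (g m)⁻¹ * leviProjection F c' (θP (leviEmbeddingP F c m)) = 1
        exact inv_mul_cancel _
      have hdec : (θ : GL n F ≃* GL n F) (blockDiagonalGL F c m) =
          ((leviEmbeddingP F c' (g m) : ↥(standardParabolicGL F c')) : GL n F) *
            (((leviEmbeddingP F c' (g m))⁻¹ * θP (leviEmbeddingP F c m) : ↥(standardParabolicGL F c')) : GL n F) := by
        rw [Subgroup.coe_mul, Subgroup.coe_inv, mul_inv_cancel_left]
        rfl
      have h1 : π' (θ (blockDiagonalGL F c m)) (Φ v) =
          π' (((leviEmbeddingP F c' (g m) : ↥(standardParabolicGL F c')) : GL n F) *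
            (((leviEmbeddingP F c' (g m))⁻¹ * θP (leviEmbeddingP F c m) : ↥(standardParabolicGL F c')) : GL n F)) (Φ v) := by
        rw [← hdec]; rfl
      rw [h1, coinvariantsMk_apply_mul_unipotent F c' π' _ hu]
      rfl
  -- transport `N` and `q`
  let N' : Subrepresentation (jacquetGL F c' π') :=
    { toSubmodule := N.toSubmodule.map (L : (restrictUnipotentGL F c π).Coinvariants →ₗ[ℂ] (restrictUnipotentGL F c' π').Coinvariants)
      apply_mem_toSubmodule := fun m' y hy => by
        obtain ⟨x, hx, rfl⟩ := hy
        refine ⟨jacquetGL F c π (f m') x, N.apply_mem_toSubmodule (f m') hx, ?_⟩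
        change L (jacquetGL F c π (f m') x) = jacquetGL F c' π' m' (L x)
        rw [hLm, hgf] }
  let eN : N.toSubmodule ≃ₗ[ℂ] N'.toSubmodule :=
    Submodule.equivMapOfInjective (L : (restrictUnipotentGL F c π).Coinvariants →ₗ[ℂ] (restrictUnipotentGL F c' π').Coinvariants) L.injective N.toSubmodule
  have heN : ∀ x : N.toSubmodule, ((eN x : N'.toSubmodule) : (restrictUnipotentGL F c' π').Coinvariants) = L (x : (restrictUnipotentGL F c π).Coinvariants) :=
    fun _ => rfl
  let q' : N'.toRepresentation.IntertwiningMap (σ.comp (e : (Π b, GL {i // c' i = b} F) →* (Π a, GL {i // c i = a} F))) :=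
    { toLinearMap := q.toLinearMap ∘ₗ eN.symm.toLinearMap
      isIntertwining' := fun m' => LinearMap.ext fun y => by
        obtain ⟨x, rfl⟩ := eN.surjective y
        have hmx : N'.toRepresentation m' (eN x) = eN (N.toRepresentation (f m') x) := by
          apply Subtype.ext
          change jacquetGL F c' π' m' (L (x : (restrictUnipotentGL F c π).Coinvariants)) = L (jacquetGL F c π (f m') (x : (restrictUnipotentGL F c π).Coinvariants))
          rw [hLm, hgf]
        simp only [LinearMap.coe_comp, LinearEquiv.coe_toLinearMap, Function.comp_apply, hmx, LinearEquiv.symm_apply_apply]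
        change q (N.toRepresentation (f m') x) = σ (e m') (q x)
        rw [he]
        exact Representation.IntertwiningMap.isIntertwining _ _ q (f m') x }
  have hq' : q' = 0 := h' _ hirr' hsm' hsc' N' q'
  refine Representation.IntertwiningMap.ext (LinearMap.ext fun x => ?_)
  have h := congrArg (fun r : N'.toRepresentation.IntertwiningMap (σ.comp (e : (Π b, GL {i // c' i = b} F) →* (Π a, GL {i // c i = a} F))) => r (eN x)) hq'
  have h2 : q' (eN x) = q x := by
    change q (eN.symm (eN x)) = q x
    rw [LinearEquiv.symm_apply_apply]
  rw [h2] at h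
  exact h

/-! ## §3 (ED. 2) The case of induced representations: `π = i_d τ`, `π' = i_{d'} (τ ∘ e_d)`, `Φ = (f ↦ f ∘ θ⁻¹)` -/

/-- **TRANSPORT OF THE WEAK CELL LEMMA FOR INDUCED REPRESENTATIONS.**  `θ` a continuous involution of `GL_n(F)` exchanging `P_c ↔ P_{c'}` (with their unipotent
radicals) AND `P_d ↔ P_{d'}` (with `θ(U_{d'}) ⊆ U_d`).  If for EVERY representation `τ'` of the Levi `M_{d'}` on `X` no `M_{c'}`-subrepresentation of
`r_{c'}(i_{d'} τ')` maps non-trivially to an irreducible smooth supercuspidal `σ'` on `W`, then for every `τ` on `X` no `M_c`-subrepresentation of `r_c(i_d τ)` maps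
non-trivially to an irreducible smooth supercuspidal `σ` on `W` (§2 with `Φ = (f ↦ f ∘ θ⁻¹) : i_d τ ≃ i_{d'} (τ ∘ e_d)`, ★ `SmoothInd.transportEquiv`, ★ `rootDeltaChar_transport`,
`e_d : M_{d'} ≃ M_d` the Levi isomorphism). [cite: BernsteinZelevinsky1977, §2.3] [cite: BernsteinZelevinsky1976, §2.21–2.25] -/
theorem ncq_jacquetGL_parabolicIndGL_of_involution {γ γ' : Type*} [LinearOrder γ] [Fintype γ] [LinearOrder γ'] [Fintype γ'] (d : n → γ) (d' : n → γ')
    [LocallyCompactSpace ↥(standardParabolicGL F c)] [LocallyCompactSpace ↥(standardParabolicGL F c')]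
    [LocallyCompactSpace ↥(standardParabolicGL F d)] [LocallyCompactSpace ↥(standardParabolicGL F d')]
    (θ : GL n F ≃ₜ* GL n F) (hθθ : ∀ g, θ (θ g) = g)
    (hP : ∀ x, θ x ∈ standardParabolicGL F c' ↔ x ∈ standardParabolicGL F c)
    (hP' : ∀ x, θ x ∈ standardParabolicGL F c ↔ x ∈ standardParabolicGL F c')
    (hU : ∀ p : ↥(standardParabolicGL F c), p ∈ unipotentRadicalP F c →
      (⟨θ p, (hP p).2 p.2⟩ : ↥(standardParabolicGL F c')) ∈ unipotentRadicalP F c')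
    (hU' : ∀ p : ↥(standardParabolicGL F c'), p ∈ unipotentRadicalP F c' →
      (⟨θ p, (hP' p).2 p.2⟩ : ↥(standardParabolicGL F c)) ∈ unipotentRadicalP F c)
    (hD : ∀ x, θ x ∈ standardParabolicGL F d' ↔ x ∈ standardParabolicGL F d)
    (hD' : ∀ x, θ x ∈ standardParabolicGL F d ↔ x ∈ standardParabolicGL F d')
    (hDU' : ∀ p : ↥(standardParabolicGL F d'), p ∈ unipotentRadicalP F d' →
      (⟨θ p, (hD' p).2 p.2⟩ : ↥(standardParabolicGL F d)) ∈ unipotentRadicalP F d)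
    {X : Type*} [AddCommGroup X] [Module ℂ X] {W : Type*} [AddCommGroup W] [Module ℂ W]
    (h' : ∀ (τ' : Representation ℂ (Π b, GL {i // d' i = b} F) X) (σ' : Representation ℂ (Π b, GL {i // c' i = b} F) W),
      σ'.IsIrreducible → σ'.IsSmooth → σ'.IsSupercuspidal →
      ∀ (N' : Subrepresentation (jacquetGL F c' (parabolicIndGL F d' τ'))) (q' : N'.toRepresentation.IntertwiningMap σ'), q' = 0)
    (τ : Representation ℂ (Π a, GL {i // d i = a} F) X)
    (σ : Representation ℂ (Π a, GL {i // c i = a} F) W) [σ.IsIrreducible] (hσ : σ.IsSmooth) (hsc : σ.IsSupercuspidal)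
    (N : Subrepresentation (jacquetGL F c (parabolicIndGL F d τ))) (q : N.toRepresentation.IntertwiningMap σ) : q = 0 := by
  -- the Levi map `fD : M_{d'} → M_d`, `fD m' = proj_d (θ (diag m'))`, and the compatibility `fD (proj_{d'} (θ p)) = proj_d p`
  let θD' : ↥(standardParabolicGL F d') →* ↥(standardParabolicGL F d) :=
    ((θ : GL n F ≃* GL n F).toMonoidHom.comp (standardParabolicGL F d').subtype).codRestrict _ fun p => (hD' p).2 p.2
  let fD : (Π b, GL {i // d' i = b} F) →* (Π a, GL {i // d i = a} F) := ((leviProjection F d).comp θD').comp (leviEmbeddingP F d')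
  have hφ : Continuous (θ : GL n F ≃* GL n F) := θ.continuous
  have hφ' : Continuous (θ : GL n F ≃* GL n F).symm := θ.symm.continuous
  have hD₁ : ∀ x, (θ : GL n F ≃* GL n F) x ∈ standardParabolicGL F d' ↔ x ∈ standardParabolicGL F d := hD
  have key : ∀ p : ↥(standardParabolicGL F d),
      fD (leviProjection F d' ⟨(θ : GL n F ≃* GL n F) p, (hD₁ p).2 p.2⟩) = leviProjection F d p := by
    intro p
    have h1 := leviProjection_apply_eq_of_ker F d' d (θ : GL n F ≃* GL n F) hD' hDU' ⟨(θ : GL n F ≃* GL n F) p, (hD₁ p).2 p.2⟩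
    have h2 : (⟨(θ : GL n F ≃* GL n F) ((⟨(θ : GL n F ≃* GL n F) p, (hD₁ p).2 p.2⟩ : ↥(standardParabolicGL F d')) : GL n F),
        (hD' _).2 (⟨(θ : GL n F ≃* GL n F) p, (hD₁ p).2 p.2⟩ : ↥(standardParabolicGL F d')).2⟩ : ↥(standardParabolicGL F d)) = p :=
      Subtype.ext (hθθ _)
    rw [h2] at h1
    exact h1.symm
  -- the transported inducing datum `τ' := τ ∘ fD` and the induced-level transport `Φ`
  have hτ : ∀ x : ↥(standardParabolicGL F d),
      Representation.twist (τ.comp (leviProjection F d)) (rootDeltaChar (standardParabolicGL F d)) x =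
        Representation.twist ((τ.comp fD).comp (leviProjection F d')) (rootDeltaChar (standardParabolicGL F d'))
          ⟨(θ : GL n F ≃* GL n F) x, (hD₁ x).2 x.2⟩ := by
    intro x
    refine LinearMap.ext fun v => ?_
    change ((rootDeltaChar (standardParabolicGL F d) x : ℂˣ) : ℂ) • τ (leviProjection F d x) v =
      ((rootDeltaChar (standardParabolicGL F d') ⟨(θ : GL n F ≃* GL n F) x, (hD₁ x).2 x.2⟩ : ℂˣ) : ℂ) •
        τ (fD (leviProjection F d' ⟨(θ : GL n F ≃* GL n F) x, (hD₁ x).2 x.2⟩)) v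
    rw [rootDeltaChar_transport (θ : GL n F ≃* GL n F) hφ hφ' hD₁ x, key x]
  have hequiv := SmoothInd.transportEquiv_smoothIndRep (θ : GL n F ≃* GL n F) hφ hφ' hD₁ hτ
  exact ncq_jacquetGL_of_continuousMulEquiv F c c' θ hθθ hP hP' hU hU' (parabolicIndGL F d τ) (parabolicIndGL F d' (τ.comp fD))
    (SmoothInd.transportEquiv (θ : GL n F ≃* GL n F) hφ hφ' hD₁ hτ) (fun g v => hequiv g v) (h' (τ.comp fD)) σ hσ hsc N q

end Summit.HodgeConjecture.HodgeConjecture.Cruxes.H413.K2E3JacquetModuleAutomorphismTransport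

end
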